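import Literature.Computability.Complexity.StackArithMul
import HarnessLib

/-!
# The verifier's arithmetic check of one stack of one record, in linear time (PPST 1983, §3)

Literature / complexity toolkit, a machine brick of the inline formalization of
Paul–Pippenger–Szemerédi–Trotter 1983 (`PaulPippengerSzemerediTrotter1983.lean`, fact
`PaulEtAl1983_NTIME_not_subset_DTIME`; roadmap Layer 4, the linear-time verifier). The check
`arith(m)` of `…Spec.lean` asks, for every stack `k` of record `m`, with `β` the height-block size,
`P`/`Q` the push/pop bounds, `b` the block length and `Bmax = |x| + |recs| · b + 1`:

  `lo ≤ Bmax`, `hi ≤ Bmax` (the size budget `SmallOK`), `lo · β ≤ mn ∸ (Q + b Q) < lo · β + β`,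
  `hi · β ≤ mx + P < hi · β + β`, `cut = lo · β`, `hib = (hi + 1) · β`, `hi ≤ lo + 1` (`ArithOK`).

This file builds the counter program `PPSTChk.chk1` performing this check on numerals held in a
bank `KR` of registers (the seven fields, `β`, `Q (b + 1)` and `Bmax` in binary, an `ok` flag and
temporaries), next to the arithmetic bank `AReg` (`StackArith.lean`) and the multiplication bank
`MOwn` (`StackArithMul.lean`), and proves its semantics and its cost:

* generic macro-steps with their simulations: `cp` (copy a `KR` register onto the arithmetic
  bank), `pushWord`, `tst`/`tstN` (fold the comparison flag into `ok`), **`leTest a b pos`**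
  (`ok := ok ∧ (b ≤ a)` or `ok := ok ∧ (a < b)`; `runs_leTest`, cost `28 (|a| + |b|) + 25`),
  `normTo`, `mulStep`, `addTo`, `addConst`, `subTo`;
* the budget test comes FIRST and the products are computed only when it passes, on NORMALIZED
  numerals: this is what makes the two multiplications cost `O((|Bmax| + |β|)²)` instead of
  `O(|field|²)` on adversarial data (`runs_chk1`);
* **`runs_chk1`** — from a clean arithmetic/multiplication bank and clean temporaries, `chk1`
  returns to the same state with `ok := ok ∧ chkCond`, within a number of steps linear in the
  field lengths plus `100 (|Bmax| + |β| + 2)²`; **`chkCond_iff`** — `chkCond` is the conjunction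
  displayed above on the values of the registers.

No named fact is introduced (definitions with bodies and theorems only).

## References

* W. J. Paul, N. Pippenger, E. Szemerédi, W. T. Trotter, *On determinism versus non-determinism
  and related problems*, FOCS 1983, 429–438, §3 (the `Σ₄` machine checks "in linear time")
  [PaulEtAl1983].
* D. E. Knuth, *The Art of Computer Programming* 2, 3rd ed. 1998, §4.3.1 [Knuth 1998].
-/

namespace Literature.Computability.Complexity

open Function Com

/-- **Registers of the one-stack arithmetic check**: the seven numeric fields of the record for
this stack, `β`, `c1 = Q (b + 1)`, `Bmax` (binary), the `ok` flag, and temporaries. [folklore] -/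
inductive KR : Type
  | ht | mn | mx | lo | hi | cut | hib | beta | c1 | bmax | ok | t | pa | pb | pc | pd | mnp | mxp
  deriving DecidableEq, Fintype, Repr

/-- All registers of the check: arithmetic bank, multiplication bank, check bank. [folklore] -/
abbrev CR : Type := MReg ⊕ KR

namespace PPSTChk

/-- An arithmetic-bank register. [folklore] -/
def ar (a : AReg) : CR := Sum.inl (Sum.inl a)
/-- A multiplication-bank register. [folklore] -/
def mo (m : MOwn) : CR := Sum.inl (Sum.inr m)
/-- A check-bank register. [folklore] -/
def kr (k : KR) : CR := Sum.inr k

/-- The register file assembled from the three banks. [folklore] -/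
def st (A : Regs AReg) (M : Regs MOwn) (G : Regs KR) : Regs CR := Sum.elim (Sum.elim A M) G

section StLemmas

variable (A : Regs AReg) (M : Regs MOwn) (G : Regs KR) (v : List Bool)

/-- `ar` is injective. [folklore] -/
@[simp] theorem ar_inj {a b : AReg} : ar a = ar b ↔ a = b := by simp [ar]
/-- `mo` is injective. [folklore] -/
@[simp] theorem mo_inj {a b : MOwn} : mo a = mo b ↔ a = b := by simp [mo]
/-- `kr` is injective. [folklore] -/
@[simp] theorem kr_inj {a b : KR} : kr a = kr b ↔ a = b := by simp [kr]
/-- The banks are disjoint. [folklore] -/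
@[simp] theorem ar_ne_mo (a : AReg) (m : MOwn) : ar a ≠ mo m := by simp [ar, mo]
/-- The banks are disjoint. [folklore] -/
@[simp] theorem mo_ne_ar (a : AReg) (m : MOwn) : mo m ≠ ar a := by simp [ar, mo]
/-- The banks are disjoint. [folklore] -/
@[simp] theorem ar_ne_kr (a : AReg) (k : KR) : ar a ≠ kr k := by simp [ar, kr]
/-- The banks are disjoint. [folklore] -/
@[simp] theorem kr_ne_ar (a : AReg) (k : KR) : kr k ≠ ar a := by simp [ar, kr]
/-- The banks are disjoint. [folklore] -/
@[simp] theorem mo_ne_kr (m : MOwn) (k : KR) : mo m ≠ kr k := by simp [mo, kr]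
/-- The banks are disjoint. [folklore] -/
@[simp] theorem kr_ne_mo (m : MOwn) (k : KR) : kr k ≠ mo m := by simp [mo, kr]

/-- Reading the arithmetic bank. [folklore] -/
@[simp] theorem st_ar (a : AReg) : st A M G (ar a) = A a := rfl
/-- Reading the multiplication bank. [folklore] -/
@[simp] theorem st_mo (m : MOwn) : st A M G (mo m) = M m := rfl
/-- Reading the check bank. [folklore] -/
@[simp] theorem st_kr (k : KR) : st A M G (kr k) = G k := rfl
/-- Writing the arithmetic bank. [folklore] -/
@[simp] theorem update_st_ar (a : AReg) : update (st A M G) (ar a) v = st (update A a v) M G := by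
  funext r
  rcases r with (a' | m) | k
  · by_cases h : a' = a
    · subst h
      show update (st A M G) (ar a') v (ar a') = update A a' v a'
      rw [update_self, update_self]
    · have h1 : (Sum.inl (Sum.inl a') : CR) ≠ ar a := fun e => h (by simpa [ar] using e)
      rw [update_of_ne h1]
      show A a' = update A a v a'
      rw [update_of_ne h]
  · have h1 : (Sum.inl (Sum.inr m) : CR) ≠ ar a := by simp [ar]
    rw [update_of_ne h1]; rfl
  · have h1 : (Sum.inr k : CR) ≠ ar a := by simp [ar]
    rw [update_of_ne h1]; rfl
/-- Writing the multiplication bank. [folklore] -/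
@[simp] theorem update_st_mo (m : MOwn) : update (st A M G) (mo m) v = st A (update M m v) G := by
  funext r
  rcases r with (a | m') | k
  · have h1 : (Sum.inl (Sum.inl a) : CR) ≠ mo m := by simp [mo]
    rw [update_of_ne h1]; rfl
  · by_cases h : m' = m
    · subst h
      show update (st A M G) (mo m') v (mo m') = update M m' v m'
      rw [update_self, update_self]
    · have h1 : (Sum.inl (Sum.inr m') : CR) ≠ mo m := fun e => h (by simpa [mo] using e)
      rw [update_of_ne h1]
      show M m' = update M m v m'
      rw [update_of_ne h]
  · have h1 : (Sum.inr k : CR) ≠ mo m := by simp [mo]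
    rw [update_of_ne h1]; rfl
/-- Writing the check bank. [folklore] -/
@[simp] theorem update_st_kr (k : KR) : update (st A M G) (kr k) v = st A M (update G k v) := by
  funext r
  rcases r with (a | m) | k'
  · have h1 : (Sum.inl (Sum.inl a) : CR) ≠ kr k := by simp [kr]
    rw [update_of_ne h1]; rfl
  · have h1 : (Sum.inl (Sum.inr m) : CR) ≠ kr k := by simp [kr]
    rw [update_of_ne h1]; rfl
  · by_cases h : k' = k
    · subst h
      show update (st A M G) (kr k') v (kr k') = update G k' v k'
      rw [update_self, update_self]
    · have h1 : (Sum.inr k' : CR) ≠ kr k := fun e => h (by simpa [kr] using e)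
      rw [update_of_ne h1]
      show G k' = update G k v k'
      rw [update_of_ne h]

end StLemmas

/-- An arithmetic-bank program, embedded. [folklore] -/
abbrev arA (c : Com AReg) : Com CR := (c.map Sum.inl).map Sum.inl
/-- A multiplication-layer program, embedded. [folklore] -/
abbrev arM (c : Com MReg) : Com CR := c.map Sum.inl

/-- Simulation of an embedded arithmetic-bank program. [folklore] -/
theorem runs_arA {c : Com AReg} {A A' : Regs AReg} {B : ℕ} (h : Runs c A A' B) (M : Regs MOwn)
    (G : Regs KR) : Runs (arA c) (st A M G) (st A' M G) B := by
  unfold st; exact (h.inl M).inl G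

/-- Simulation of an embedded multiplication-layer program. [folklore] -/
theorem runs_arM {c : Com MReg} {A A' : Regs AReg} {M M' : Regs MOwn} {B : ℕ}
    (h : Runs c (Sum.elim A M) (Sum.elim A' M') B) (G : Regs KR) :
    Runs (arM c) (st A M G) (st A' M' G) B := by
  unfold st; exact h.inl G

/-! ### Macro-steps -/

/-- Copy check register `k` onto arithmetic register `a` (temporaries `s`, `t`). [folklore] -/
def cp (k : KR) (a : AReg) : Com CR := copy (kr k) (ar a) (ar .s) (ar .t)

/-- Simulation of `cp`. [folklore] -/
theorem runs_cp (k : KR) {a : AReg} (has : a ≠ .s) (hat : a ≠ .t) (A : Regs AReg) (M : Regs MOwn)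
    (G : Regs KR) (hs : A .s = []) (ht : A .t = []) :
    Runs (cp k a) (st A M G) (st (update A a (G k ++ A a)) M G) (10 * (G k).length + 3) := by
  have h := runs_copy (a := kr k) (b := ar a) (t := ar .s) (u := ar .t) (by simp) (by simp)
    (by simp) (by simp [has]) (by simp [hat]) (by simp) (st A M G) (by simpa using hs)
    (by simpa using ht)
  simp only [st_kr, st_ar, update_st_ar] at h
  exact h

/-- Push the word `w` (bottom first) onto register `r`. [folklore] -/
def pushWord (r : CR) : List Bool → Com CR
  | [] => skip
  | b :: w => pushWord r w ;; push r b

/-- Simulation of `pushWord`. [folklore] -/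
theorem runs_pushWord (r : CR) : ∀ (w : List Bool) (R : Regs CR),
    Runs (pushWord r w) R (update R r (w ++ R r)) w.length
  | [], R => by simpa [pushWord] using Runs.skip R
  | b :: w, R => by
    have h1 := runs_pushWord r w R
    have h2 := Runs.push r b (update R r (w ++ R r))
    refine ((h1.seq h2).of_eq ?_ (by simp))
    simp

/-- Fold the comparison flag `g` into `ok`, positively: keep `ok` iff `g` is set. [folklore] -/
def tst : Com CR := pop (ar .g) skip skip (clear (kr .ok))

/-- Fold the comparison flag `g` into `ok`, negatively: keep `ok` iff `g` is clear. [folklore] -/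
def tstN : Com CR := pop (ar .g) (clear (kr .ok)) skip skip

/-- Simulation of `tst`. [folklore] -/
theorem runs_tst (xv yv zv : List Bool) (c o : Bool) (M : Regs MOwn) (G : Regs KR)
    (hok : G .ok = flag o) :
    Runs tst (st (AReg.file xv yv zv [] [] [] [] (flag c)) M G)
      (st (AReg.file xv yv zv [] [] [] [] []) M (update G .ok (flag (o && c)))) 5 := by
  cases c
  · have h := runs_clear (kr .ok) (st (AReg.file xv yv zv [] [] [] [] []) M G)
    simp only [st_kr, update_st_kr] at h
    refine (Runs.pop_nil skip skip (by simp) h).of_eq (by simp) ?_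
    cases o <;> simp [hok]
  · refine (Runs.pop_true' skip (clear (kr KR.ok)) (w := []) (by simp) rfl (Runs.skip _)).of_eq ?_
      (by omega)
    simp only [update_st_ar, AReg.update_file_g, Bool.and_true]
    rw [← hok, update_eq_self]

/-- Simulation of `tstN`. [folklore] -/
theorem runs_tstN (xv yv zv : List Bool) (c o : Bool) (M : Regs MOwn) (G : Regs KR)
    (hok : G .ok = flag o) :
    Runs tstN (st (AReg.file xv yv zv [] [] [] [] (flag c)) M G)
      (st (AReg.file xv yv zv [] [] [] [] []) M (update G .ok (flag (o && !c)))) 5 := by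
  cases c
  · refine (Runs.pop_nil (clear (kr KR.ok)) skip (by simp) (Runs.skip _)).of_eq ?_ (by omega)
    simp only [Bool.not_false, Bool.and_true, flag_false]
    rw [← hok, update_eq_self]
  · have h := runs_clear (kr .ok) (st (AReg.file xv yv zv [] [] [] [] []) M G)
    simp only [st_kr, update_st_kr] at h
    refine (Runs.pop_true' skip skip (w := []) (by simp) (by simp) h).of_eq (by simp) ?_
    cases o <;> simp [hok]

/-- **The comparison test**: `ok := ok ∧ (b ≤ a)` (`pos = true`) or `ok := ok ∧ (a < b)`
(`pos = false`), on the VALUES of the check registers `a`, `b`; the arithmetic bank is used and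
left clean. [folklore] -/
def leTest (a b : KR) (pos : Bool) : Com CR :=
  cp a .x ;; cp b .y ;; arA sub ;; (bif pos then tst else tstN) ;; clear (ar .x) ;; clear (ar .y)

/-- The outcome of a comparison test. [folklore] -/
def leVal (G : Regs KR) (a b : KR) (pos : Bool) : Bool :=
  bif pos then decide (bitsToNat (G b) ≤ bitsToNat (G a))
  else decide (bitsToNat (G a) < bitsToNat (G b))

/-- **Simulation of `leTest`.** [folklore] -/
theorem runs_leTest (a b : KR) (pos o : Bool) (zv : List Bool) (M : Regs MOwn) (G : Regs KR)
    (hok : G .ok = flag o) :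
    Runs (leTest a b pos) (st (AReg.file [] [] zv [] [] [] [] []) M G)
      (st (AReg.file [] [] zv [] [] [] [] []) M (update G .ok (flag (o && leVal G a b pos))))
      (28 * ((G a).length + (G b).length) + 25) := by
  have h1 := runs_cp a (a := .x) (by decide) (by decide) (AReg.file [] [] zv [] [] [] [] []) M G
    rfl rfl
  simp only [AReg.file_x, List.append_nil, AReg.update_file_x] at h1
  have h2 := runs_cp b (a := .y) (by decide) (by decide) (AReg.file (G a) [] zv [] [] [] [] []) M G
    rfl rfl
  simp only [AReg.file_y, List.append_nil, AReg.update_file_y] at h2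
  have h3 := runs_arA (runs_sub (G a) (G b) zv) M G
  have hb := subBorrow_iff (G a) (G b)
  set xr := (bif subBorrow (G a) (G b) then G a else subRes (G a) (G b)) with hxr
  have hxl : xr.length = (G a).length := by
    rw [hxr]; cases subBorrow (G a) (G b) <;> simp [length_subRes]
  have h4 : Runs (bif pos then tst else tstN)
      (st (AReg.file xr (G b) zv [] [] [] [] (flag !subBorrow (G a) (G b))) M G)
      (st (AReg.file xr (G b) zv [] [] [] [] []) M (update G .ok (flag (o && leVal G a b pos)))) 5 := by
    cases pos
    · have := runs_tstN xr (G b) zv (!subBorrow (G a) (G b)) o M G hok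
      simp only [Bool.not_not] at this
      refine this.of_eq ?_ le_rfl
      simp [leVal, hb]
    · have := runs_tst xr (G b) zv (!subBorrow (G a) (G b)) o M G hok
      refine this.of_eq ?_ le_rfl
      have e : (!decide (bitsToNat (G a) < bitsToNat (G b))) =
          decide (bitsToNat (G b) ≤ bitsToNat (G a)) := by
        by_cases hle : bitsToNat (G b) ≤ bitsToNat (G a)
        · simp [hle, Nat.not_lt.2 hle]
        · simp [hle, Nat.lt_of_not_le hle]
      simp [leVal, hb, e]
  set G' := update G .ok (flag (o && leVal G a b pos))
  have h5 := runs_clear (ar .x) (st (AReg.file xr (G b) zv [] [] [] [] []) M G')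
  simp only [st_ar, AReg.file_x, update_st_ar, AReg.update_file_x] at h5
  have h6 := runs_clear (ar .y) (st (AReg.file [] (G b) zv [] [] [] [] []) M G')
  simp only [st_ar, AReg.file_y, update_st_ar, AReg.update_file_y] at h6
  refine (h1.seq (h2.seq (h3.seq (h4.seq (h5.seq h6))))).of_eq rfl ?_
  rw [hxl]; omega

/-- Normalize check register `k` onto `x`: `x := norm (G k)`. [folklore] -/
def normTo (k : KR) : Com CR := cp k .x ;; arA normalize

/-- Simulation of `normTo`. [folklore] -/
theorem runs_normTo (k : KR) (zv : List Bool) (M : Regs MOwn) (G : Regs KR) :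
    Runs (normTo k) (st (AReg.file [] [] zv [] [] [] [] []) M G)
      (st (AReg.file (norm (G k)) [] zv [] [] [] [] []) M G) (19 * (G k).length + 8) := by
  have h1 := runs_cp k (a := .x) (by decide) (by decide) (AReg.file [] [] zv [] [] [] [] []) M G
    rfl rfl
  simp only [AReg.file_x, List.append_nil, AReg.update_file_x] at h1
  have h2 := runs_arA (runs_normalize (G k) [] zv [] [] []) M G
  exact (h1.seq h2).of_eq rfl (by omega)

/-- Multiply `x` by `β` into check register `dst`: `p := x`, `q := β`, `mul`, `dst := r`.
[Knuth 1998, §4.3.1, Algorithm M] [folklore] -/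
def mulStep (dst : KR) : Com CR :=
  move (ar .x) (mo .p) (ar .s) ;; copy (kr .beta) (mo .q) (ar .s) (ar .t) ;; arM mul ;;
    move (mo .r) (kr dst) (ar .s)

/-- Simulation of `mulStep`. [folklore] -/
theorem runs_mulStep (dst : KR) (xs zv : List Bool) (G : Regs KR)
    (hd : G dst = []) :
    Runs (mulStep dst) (st (AReg.file xs [] zv [] [] [] [] []) (MOwn.file [] [] [] []) G)
      (st (AReg.file [] [] zv [] [] [] [] []) (MOwn.file [] [] [] [])
        (update G dst (mulRes xs (G .beta))))
      (12 * xs.length + 16 * (G KR.beta).length + 50 * (xs.length + (G KR.beta).length + 1) ^ 2 +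
        15) := by
  have h1 := runs_move (a := ar .x) (b := mo .p) (t := ar .s) (by simp) (by simp) (by simp)
    (st (AReg.file xs [] zv [] [] [] [] []) (MOwn.file [] [] [] []) G) rfl
  simp only [st_ar, AReg.file_x, st_mo, MOwn.file_p, List.append_nil, update_st_ar,
    AReg.update_file_x, update_st_mo, MOwn.update_file_p] at h1
  have h2 := runs_copy (a := kr .beta) (b := mo .q) (t := ar .s) (u := ar .t) (by simp) (by simp)
    (by simp) (by simp) (by simp) (by simp)
    (st (AReg.file [] [] zv [] [] [] [] []) (MOwn.file xs [] [] []) G) rfl rfl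
  simp only [st_kr, st_mo, MOwn.file_q, List.append_nil, update_st_mo, MOwn.update_file_q] at h2
  have h3 := runs_arM (runs_mul xs (G .beta) zv [] [] []) G
  have h4 := runs_move (a := mo .r) (b := kr dst) (t := ar .s) (by simp) (by simp) (by simp)
    (st (AReg.file [] [] zv [] [] [] [] []) (MOwn.file [] [] (mulRes xs (G .beta)) []) G) rfl
  simp only [st_mo, MOwn.file_r, st_kr, hd, List.append_nil, update_st_mo, MOwn.update_file_r,
    update_st_kr] at h4
  have hl := length_mulRes_le xs (G .beta)
  refine (h1.seq (h2.seq (h3.seq h4))).of_eq rfl ?_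
  nlinarith [hl, Nat.zero_le xs.length, Nat.zero_le (G KR.beta).length]

/-- `dst := a + b` on values (check registers; `dst` initially empty). [folklore] -/
def addTo (a b dst : KR) : Com CR :=
  cp a .x ;; cp b .y ;; arA add ;; clear (ar .y) ;; move (ar .x) (kr dst) (ar .s)

/-- Simulation of `addTo`. [folklore] -/
theorem runs_addTo (a b dst : KR) (zv : List Bool) (M : Regs MOwn) (G : Regs KR) (hd : G dst = []) :
    Runs (addTo a b dst) (st (AReg.file [] [] zv [] [] [] [] []) M G)
      (st (AReg.file [] [] zv [] [] [] [] []) M (update G dst (addRes (G a) (G b))))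
      (31 * ((G a).length + (G b).length) + 27) := by
  have h1 := runs_cp a (a := .x) (by decide) (by decide) (AReg.file [] [] zv [] [] [] [] []) M G
    rfl rfl
  simp only [AReg.file_x, List.append_nil, AReg.update_file_x] at h1
  have h2 := runs_cp b (a := .y) (by decide) (by decide) (AReg.file (G a) [] zv [] [] [] [] []) M G
    rfl rfl
  simp only [AReg.file_y, List.append_nil, AReg.update_file_y] at h2
  have h3 := runs_arA (runs_add (G a) (G b) zv [] []) M G
  have h4 := runs_clear (ar .y) (st (AReg.file (addRes (G a) (G b)) (G b) zv [] [] [] [] []) M G)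
  simp only [st_ar, AReg.file_y, update_st_ar, AReg.update_file_y] at h4
  have h5 := runs_move (a := ar .x) (b := kr dst) (t := ar .s) (by simp) (by simp) (by simp)
    (st (AReg.file (addRes (G a) (G b)) [] zv [] [] [] [] []) M G) rfl
  simp only [st_ar, AReg.file_x, st_kr, hd, List.append_nil, update_st_ar, AReg.update_file_x,
    update_st_kr] at h5
  have hl := length_addRes_le (G a) (G b)
  refine (h1.seq (h2.seq (h3.seq (h4.seq h5)))).of_eq rfl ?_
  omega

/-- `dst := a + w` for a constant word `w` (`dst` initially empty). [folklore] -/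
def addConst (a : KR) (w : List Bool) (dst : KR) : Com CR :=
  cp a .x ;; pushWord (ar .y) w ;; arA add ;; clear (ar .y) ;; move (ar .x) (kr dst) (ar .s)

/-- Simulation of `addConst`. [folklore] -/
theorem runs_addConst (a : KR) (w : List Bool) (dst : KR) (zv : List Bool) (M : Regs MOwn)
    (G : Regs KR) (hd : G dst = []) :
    Runs (addConst a w dst) (st (AReg.file [] [] zv [] [] [] [] []) M G)
      (st (AReg.file [] [] zv [] [] [] [] []) M (update G dst (addRes (G a) w)))
      (31 * ((G a).length + w.length) + 24) := by
  have h1 := runs_cp a (a := .x) (by decide) (by decide) (AReg.file [] [] zv [] [] [] [] []) M G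
    rfl rfl
  simp only [AReg.file_x, List.append_nil, AReg.update_file_x] at h1
  have h2 := runs_pushWord (ar .y) w (st (AReg.file (G a) [] zv [] [] [] [] []) M G)
  simp only [st_ar, AReg.file_y, List.append_nil, update_st_ar, AReg.update_file_y] at h2
  have h3 := runs_arA (runs_add (G a) w zv [] []) M G
  have h4 := runs_clear (ar .y) (st (AReg.file (addRes (G a) w) w zv [] [] [] [] []) M G)
  simp only [st_ar, AReg.file_y, update_st_ar, AReg.update_file_y] at h4
  have h5 := runs_move (a := ar .x) (b := kr dst) (t := ar .s) (by simp) (by simp) (by simp)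
    (st (AReg.file (addRes (G a) w) [] zv [] [] [] [] []) M G) rfl
  simp only [st_ar, AReg.file_x, st_kr, hd, List.append_nil, update_st_ar, AReg.update_file_x,
    update_st_kr] at h5
  have hl := length_addRes_le (G a) w
  refine (h1.seq (h2.seq (h3.seq (h4.seq h5)))).of_eq rfl ?_
  omega

/-- The truncated difference as a word: the difference bits when there is no borrow, else `ε`.
[folklore] -/
def tsub (xs ys : List Bool) : List Bool := bif subBorrow xs ys then [] else subRes xs ys

/-- The value of `tsub`. [folklore] -/
theorem bitsToNat_tsub (xs ys : List Bool) : bitsToNat (tsub xs ys) = bitsToNat xs - bitsToNat ys := by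
  unfold tsub
  rw [subBorrow_iff]
  by_cases h : bitsToNat xs < bitsToNat ys
  · simp [h, Nat.sub_eq_zero_of_le h.le]
  · simp [h, bitsToNat_subRes xs ys (Nat.not_lt.1 h)]

/-- The length of `tsub`. [folklore] -/
theorem length_tsub_le (xs ys : List Bool) : (tsub xs ys).length ≤ xs.length := by
  unfold tsub; cases subBorrow xs ys <;> simp [length_subRes]

/-- `dst := a ∸ b` on values (`dst` initially empty). [folklore] -/
def subTo (a b dst : KR) : Com CR :=
  cp a .x ;; cp b .y ;; arA sub ;;
    pop (ar .g) (move (ar .x) (kr dst) (ar .s)) skip (clear (ar .x)) ;; clear (ar .y)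

/-- Simulation of `subTo`. [folklore] -/
theorem runs_subTo (a b dst : KR) (zv : List Bool) (M : Regs MOwn) (G : Regs KR) (hd : G dst = []) :
    Runs (subTo a b dst) (st (AReg.file [] [] zv [] [] [] [] []) M G)
      (st (AReg.file [] [] zv [] [] [] [] []) M (update G dst (tsub (G a) (G b))))
      (34 * ((G a).length + (G b).length) + 23) := by
  have h1 := runs_cp a (a := .x) (by decide) (by decide) (AReg.file [] [] zv [] [] [] [] []) M G
    rfl rfl
  simp only [AReg.file_x, List.append_nil, AReg.update_file_x] at h1
  have h2 := runs_cp b (a := .y) (by decide) (by decide) (AReg.file (G a) [] zv [] [] [] [] []) M G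
    rfl rfl
  simp only [AReg.file_y, List.append_nil, AReg.update_file_y] at h2
  have h3 := runs_arA (runs_sub (G a) (G b) zv) M G
  have h4 : Runs (pop (ar .g) (move (ar .x) (kr dst) (ar .s)) skip (clear (ar .x)))
      (st (AReg.file (bif subBorrow (G a) (G b) then G a else subRes (G a) (G b)) (G b) zv [] []
        [] [] (flag !subBorrow (G a) (G b))) M G)
      (st (AReg.file [] (G b) zv [] [] [] [] []) M (update G dst (tsub (G a) (G b))))
      (6 * (G a).length + 4) := by
    cases hb : subBorrow (G a) (G b)
    · -- no borrow: move the difference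
      have h := runs_move (a := ar .x) (b := kr dst) (t := ar .s) (by simp) (by simp) (by simp)
        (st (AReg.file (subRes (G a) (G b)) (G b) zv [] [] [] [] []) M G) rfl
      simp only [st_ar, AReg.file_x, st_kr, hd, List.append_nil, update_st_ar,
        AReg.update_file_x, update_st_kr] at h
      refine (Runs.pop_true' skip (clear (ar AReg.x)) (w := []) (by simp) (by simp) h).of_eq
        (by simp [tsub, hb]) (by simp [length_subRes])
    · -- borrow: the truncated difference is `0`
      have h := runs_clear (ar .x) (st (AReg.file (G a) (G b) zv [] [] [] [] []) M G)
      simp only [st_ar, AReg.file_x, update_st_ar, AReg.update_file_x] at h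
      refine (Runs.pop_nil (move (ar AReg.x) (kr dst) (ar AReg.s)) skip (by simp) h).of_eq ?_ ?_
      · simp only [tsub, hb, cond_true]
        rw [← hd, update_eq_self]
      · omega
  have h5 := runs_clear (ar .y)
    (st (AReg.file [] (G b) zv [] [] [] [] []) M (update G dst (tsub (G a) (G b))))
  simp only [st_ar, AReg.file_y, update_st_ar, AReg.update_file_y] at h5
  refine (h1.seq (h2.seq (h3.seq (h4.seq h5)))).of_eq rfl ?_
  omega

/-! ### The products stage -/

/-- Products for `lo`: `pa := norm lo · β`, `pb := pa + β`. [folklore] -/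
def prodLo : Com CR := normTo .lo ;; mulStep .pa ;; addTo .pa .beta .pb

/-- Products for `hi`: `pc := norm hi · β`, `pd := pc + β`. [folklore] -/
def prodHi : Com CR := normTo .hi ;; mulStep .pc ;; addTo .pc .beta .pd

/-- The other two operands: `mxp := mx + P`, `mnp := mn ∸ c1`. [folklore] -/
def prodRest (wP : List Bool) : Com CR := addConst .mx wP .mxp ;; subTo .mn .c1 .mnp

/-- `pa`. [folklore] -/
def PA (G : Regs KR) : List Bool := mulRes (norm (G .lo)) (G .beta)
/-- `pb`. [folklore] -/
def PB (G : Regs KR) : List Bool := addRes (PA G) (G .beta)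
/-- `pc`. [folklore] -/
def PC (G : Regs KR) : List Bool := mulRes (norm (G .hi)) (G .beta)
/-- `pd`. [folklore] -/
def PD (G : Regs KR) : List Bool := addRes (PC G) (G .beta)

/-- Value of `pa`. [folklore] -/
@[simp] theorem bitsToNat_PA (G : Regs KR) :
    bitsToNat (PA G) = bitsToNat (G .lo) * bitsToNat (G .beta) := by
  simp [PA, bitsToNat_mulRes]
/-- Value of `pb`. [folklore] -/
@[simp] theorem bitsToNat_PB (G : Regs KR) :
    bitsToNat (PB G) = bitsToNat (G .lo) * bitsToNat (G .beta) + bitsToNat (G .beta) := by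
  simp [PB, bitsToNat_addRes]
/-- Value of `pc`. [folklore] -/
@[simp] theorem bitsToNat_PC (G : Regs KR) :
    bitsToNat (PC G) = bitsToNat (G .hi) * bitsToNat (G .beta) := by
  simp [PC, bitsToNat_mulRes]
/-- Value of `pd`. [folklore] -/
@[simp] theorem bitsToNat_PD (G : Regs KR) :
    bitsToNat (PD G) = bitsToNat (G .hi) * bitsToNat (G .beta) + bitsToNat (G .beta) := by
  simp [PD, bitsToNat_addRes]

/-- Length of `pa` under the budget. [folklore] -/
theorem length_PA_le (G : Regs KR) {LB : ℕ} (h : (bitsToNat (G .lo)).size ≤ LB) :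
    (PA G).length ≤ LB + (G .beta).length + 1 := by
  have h1 := length_mulRes_le (norm (G .lo)) (G .beta)
  have h2 := length_norm (G .lo)
  unfold PA; omega
/-- Length of `pb` under the budget. [folklore] -/
theorem length_PB_le (G : Regs KR) {LB : ℕ} (h : (bitsToNat (G .lo)).size ≤ LB) :
    (PB G).length ≤ LB + 2 * (G .beta).length + 2 := by
  have h1 := length_PA_le G h
  have h2 := length_addRes_le (PA G) (G .beta)
  unfold PB; omega
/-- Length of `pc` under the budget. [folklore] -/
theorem length_PC_le (G : Regs KR) {LB : ℕ} (h : (bitsToNat (G .hi)).size ≤ LB) :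
    (PC G).length ≤ LB + (G .beta).length + 1 := by
  have h1 := length_mulRes_le (norm (G .hi)) (G .beta)
  have h2 := length_norm (G .hi)
  unfold PC; omega
/-- Length of `pd` under the budget. [folklore] -/
theorem length_PD_le (G : Regs KR) {LB : ℕ} (h : (bitsToNat (G .hi)).size ≤ LB) :
    (PD G).length ≤ LB + 2 * (G .beta).length + 2 := by
  have h1 := length_PC_le G h
  have h2 := length_addRes_le (PC G) (G .beta)
  unfold PD; omega

/-- Simulation of `prodLo`. [folklore] -/
theorem runs_prodLo (zv : List Bool) (G : Regs KR) (hpa : G .pa = []) (hpb : G .pb = []) {LB : ℕ}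
    (hLB : (bitsToNat (G .lo)).size ≤ LB) :
    Runs prodLo (st (AReg.file [] [] zv [] [] [] [] []) (MOwn.file [] [] [] []) G)
      (st (AReg.file [] [] zv [] [] [] [] []) (MOwn.file [] [] [] [])
        (update (update G .pa (PA G)) .pb (PB G)))
      (19 * (G KR.lo).length + 50 * (LB + (G KR.beta).length + 1) ^ 2 +
        78 * (LB + (G KR.beta).length + 1) + 50) := by
  have h1 := runs_normTo .lo zv (MOwn.file [] [] [] []) G
  have h2 := runs_mulStep .pa (norm (G .lo)) zv G hpa
  have h3 := runs_addTo .pa .beta .pb zv (MOwn.file [] [] [] []) (update G .pa (PA G))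
    (by simp [hpb])
  simp only [update_self, ne_eq, reduceCtorEq, not_false_eq_true, update_of_ne] at h3
  have hnl : (norm (G .lo)).length ≤ LB := by rw [length_norm]; exact hLB
  have hPA := length_PA_le G hLB
  have hsq := Nat.pow_le_pow_left
    (show (norm (G .lo)).length + (G KR.beta).length + 1 ≤ LB + (G KR.beta).length + 1 by omega) 2
  refine (h1.seq (h2.seq h3)).of_eq (by rfl) ?_
  unfold PA at hPA ⊢
  omega

/-- Simulation of `prodHi`. [folklore] -/
theorem runs_prodHi (zv : List Bool) (G : Regs KR) (hpc : G .pc = []) (hpd : G .pd = []) {LB : ℕ}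
    (hLB : (bitsToNat (G .hi)).size ≤ LB) :
    Runs prodHi (st (AReg.file [] [] zv [] [] [] [] []) (MOwn.file [] [] [] []) G)
      (st (AReg.file [] [] zv [] [] [] [] []) (MOwn.file [] [] [] [])
        (update (update G .pc (PC G)) .pd (PD G)))
      (19 * (G KR.hi).length + 50 * (LB + (G KR.beta).length + 1) ^ 2 +
        78 * (LB + (G KR.beta).length + 1) + 50) := by
  have h1 := runs_normTo .hi zv (MOwn.file [] [] [] []) G
  have h2 := runs_mulStep .pc (norm (G .hi)) zv G hpc
  have h3 := runs_addTo .pc .beta .pd zv (MOwn.file [] [] [] []) (update G .pc (PC G))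
    (by simp [hpd])
  simp only [update_self, ne_eq, reduceCtorEq, not_false_eq_true, update_of_ne] at h3
  have hnl : (norm (G .hi)).length ≤ LB := by rw [length_norm]; exact hLB
  have hPC := length_PC_le G hLB
  have hsq := Nat.pow_le_pow_left
    (show (norm (G .hi)).length + (G KR.beta).length + 1 ≤ LB + (G KR.beta).length + 1 by omega) 2
  refine (h1.seq (h2.seq h3)).of_eq (by rfl) ?_
  unfold PC at hPC ⊢
  omega

/-- Simulation of `prodRest`. [folklore] -/
theorem runs_prodRest (wP zv : List Bool) (M : Regs MOwn) (G : Regs KR) (hmxp : G .mxp = [])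
    (hmnp : G .mnp = []) :
    Runs (prodRest wP) (st (AReg.file [] [] zv [] [] [] [] []) M G)
      (st (AReg.file [] [] zv [] [] [] [] []) M
        (update (update G .mxp (addRes (G .mx) wP)) .mnp (tsub (G .mn) (G .c1))))
      (31 * ((G KR.mx).length + wP.length) + 34 * ((G KR.mn).length + (G KR.c1).length) + 47) := by
  have h1 := runs_addConst .mx wP .mxp zv M G hmxp
  have h2 := runs_subTo .mn .c1 .mnp zv M (update G .mxp (addRes (G .mx) wP)) (by simp [hmnp])
  simp only [ne_eq, reduceCtorEq, not_false_eq_true, update_of_ne] at h2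
  exact (h1.seq h2).of_eq rfl (by omega)

/-- **The products stage.** [folklore] -/
def prods (wP : List Bool) : Com CR := prodLo ;; prodHi ;; prodRest wP

/-- The check bank after the products stage. [folklore] -/
def afterProds (G : Regs KR) (wP : List Bool) : Regs KR :=
  update (update (update (update (update (update G .pa (PA G)) .pb (PB G)) .pc (PC G)) .pd (PD G))
    .mxp (addRes (G .mx) wP)) .mnp (tsub (G .mn) (G .c1))

/-- **Simulation of the products stage.** [folklore] -/
theorem runs_prods (wP zv : List Bool) (G : Regs KR) (hpa : G .pa = []) (hpb : G .pb = [])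
    (hpc : G .pc = []) (hpd : G .pd = []) (hmxp : G .mxp = []) (hmnp : G .mnp = []) {LB : ℕ}
    (hlo : (bitsToNat (G .lo)).size ≤ LB) (hhi : (bitsToNat (G .hi)).size ≤ LB) :
    Runs (prods wP) (st (AReg.file [] [] zv [] [] [] [] []) (MOwn.file [] [] [] []) G)
      (st (AReg.file [] [] zv [] [] [] [] []) (MOwn.file [] [] [] []) (afterProds G wP))
      (19 * ((G KR.lo).length + (G KR.hi).length) + 31 * ((G KR.mx).length + wP.length) +
        34 * ((G KR.mn).length + (G KR.c1).length) + 100 * (LB + (G KR.beta).length + 1) ^ 2 +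
        156 * (LB + (G KR.beta).length + 1) + 147) := by
  have h1 := runs_prodLo zv G hpa hpb hlo
  set G₁ := update (update G .pa (PA G)) .pb (PB G) with hG₁
  have h2 := runs_prodHi zv G₁ (by simp [G₁, hpc]) (by simp [G₁, hpd]) (LB := LB) (by simpa [G₁] using hhi)
  have e1 : PC G₁ = PC G := by simp [PC, G₁]
  have e2 : PD G₁ = PD G := by simp [PD, PC, G₁]
  have e3 : G₁ .hi = G .hi := by simp [G₁]
  have e4 : G₁ .beta = G .beta := by simp [G₁]
  rw [e1, e2, e3, e4] at h2
  set G₂ := update (update G₁ .pc (PC G)) .pd (PD G) with hG₂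
  have h3 := runs_prodRest wP zv (MOwn.file [] [] [] []) G₂ (by simp [G₂, G₁, hmxp])
    (by simp [G₂, G₁, hmnp])
  have e5 : G₂ .mx = G .mx := by simp [G₂, G₁]
  have e6 : G₂ .mn = G .mn := by simp [G₂, G₁]
  have e7 : G₂ .c1 = G .c1 := by simp [G₂, G₁]
  rw [e5, e6, e7] at h3
  refine (h1.seq (h2.seq h3)).of_eq ?_ (by omega)
  rfl

/-! ### Sequences of tests and of clears -/

/-- A sequence of comparison tests. [folklore] -/
def leTests : List (KR × KR × Bool) → Com CR
  | [] => skip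
  | (a, b, p) :: L => leTest a b p ;; leTests L

/-- The conjunction of a sequence of comparison tests. [folklore] -/
def allVal (G : Regs KR) : List (KR × KR × Bool) → Bool
  | [] => true
  | (a, b, p) :: L => leVal G a b p && allVal G L

/-- The cost of a sequence of comparison tests. [folklore] -/
def testsCost (G : Regs KR) : List (KR × KR × Bool) → ℕ
  | [] => 0
  | (a, b, _) :: L => 28 * ((G a).length + (G b).length) + 25 + testsCost G L

/-- A test list avoiding `ok`. [folklore] -/
def OkFree (L : List (KR × KR × Bool)) : Prop := ∀ x ∈ L, x.1 ≠ KR.ok ∧ x.2.1 ≠ KR.ok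

/-- `leVal` ignores registers other than its operands. [folklore] -/
theorem leVal_update_of_ne (G : Regs KR) {k a b : KR} (v : List Bool) (ha : a ≠ k) (hb : b ≠ k)
    (p : Bool) : leVal (update G k v) a b p = leVal G a b p := by
  simp [leVal, update_of_ne ha, update_of_ne hb]

/-- `allVal` ignores `ok` on an `ok`-free list. [folklore] -/
theorem allVal_update_ok (G : Regs KR) (v : List Bool) :
    ∀ L, OkFree L → allVal (update G .ok v) L = allVal G L
  | [], _ => rfl
  | (a, b, p) :: L, hL => by
    have h0 := hL (a, b, p) (by simp)
    simp only [allVal]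
    rw [leVal_update_of_ne G v h0.1 h0.2, allVal_update_ok G v L (fun x hx => hL x (by simp [hx]))]

/-- `testsCost` ignores `ok` on an `ok`-free list. [folklore] -/
theorem testsCost_update_ok (G : Regs KR) (v : List Bool) :
    ∀ L, OkFree L → testsCost (update G .ok v) L = testsCost G L
  | [], _ => rfl
  | (a, b, p) :: L, hL => by
    have h0 := hL (a, b, p) (by simp)
    simp only [testsCost]
    rw [update_of_ne h0.1, update_of_ne h0.2,
      testsCost_update_ok G v L (fun x hx => hL x (by simp [hx]))]

/-- **Simulation of a sequence of tests.** [folklore] -/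
theorem runs_leTests (zv : List Bool) (M : Regs MOwn) :
    ∀ (L : List (KR × KR × Bool)), OkFree L → ∀ (G : Regs KR) (o : Bool), G .ok = flag o →
      Runs (leTests L) (st (AReg.file [] [] zv [] [] [] [] []) M G)
        (st (AReg.file [] [] zv [] [] [] [] []) M (update G .ok (flag (o && allVal G L))))
        (testsCost G L)
  | [], _, G, o, hok => by
    refine (Runs.skip _).of_eq ?_ (by simp [testsCost])
    simp only [allVal, Bool.and_true]
    rw [← hok, update_eq_self]
  | (a, b, p) :: L, hL, G, o, hok => by
    have h1 := runs_leTest a b p o zv M G hok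
    have hL' : OkFree L := fun x hx => hL x (by simp [hx])
    have h2 := runs_leTests zv M L hL' (update G .ok (flag (o && leVal G a b p))) (o && leVal G a b p)
      (by simp)
    rw [allVal_update_ok G _ L hL', testsCost_update_ok G _ L hL', update_idem] at h2
    refine (h1.seq h2).of_eq ?_ ?_
    · simp only [allVal, Bool.and_assoc]
    · simp [testsCost]

/-- A sequence of clears of check registers. [folklore] -/
def clears : List KR → Com CR
  | [] => skip
  | k :: ks => clear (kr k) ;; clears ks

/-- The bank after a sequence of clears. [folklore] -/
def cleared (G : Regs KR) : List KR → Regs KR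
  | [] => G
  | k :: ks => cleared (update G k []) ks

/-- The cost of a sequence of clears. [folklore] -/
def clearsCost (G : Regs KR) : List KR → ℕ
  | [] => 0
  | k :: ks => 2 * (G k).length + 1 + clearsCost (update G k []) ks

/-- Simulation of a sequence of clears. [folklore] -/
theorem runs_clears (A : Regs AReg) (M : Regs MOwn) :
    ∀ (ks : List KR) (G : Regs KR),
      Runs (clears ks) (st A M G) (st A M (cleared G ks)) (clearsCost G ks)
  | [], G => by simpa [clears, cleared, clearsCost] using Runs.skip (st A M G)
  | k :: ks, G => by
    have h1 := runs_clear (kr k) (st A M G)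
    simp only [st_kr, update_st_kr] at h1
    have h2 := runs_clears A M ks (update G k [])
    exact (h1.seq h2).of_eq rfl (by simp [clearsCost])

/-- A cleared register outside the list is unchanged. [folklore] -/
theorem cleared_of_not_mem : ∀ (ks : List KR) (G : Regs KR) (j : KR), j ∉ ks →
    cleared G ks j = G j
  | [], _, _, _ => rfl
  | k :: ks, G, j, hj => by
    simp only [List.mem_cons, not_or] at hj
    rw [cleared, cleared_of_not_mem ks _ j hj.2, update_of_ne hj.1]

/-- A cleared register in the list is empty. [folklore] -/
theorem cleared_of_mem : ∀ (ks : List KR) (G : Regs KR) (j : KR), j ∈ ks → cleared G ks j = []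
  | [], _, _, hj => by simp at hj
  | k :: ks, G, j, hj => by
    rw [cleared]
    by_cases hjk : j ∈ ks
    · exact cleared_of_mem ks _ j hjk
    · have : j = k := by simpa [hjk] using hj
      subst this
      rw [cleared_of_not_mem ks _ j hjk, update_self]

/-- The cost of clears is bounded by the total length. [folklore] -/
theorem clearsCost_le : ∀ (ks : List KR) (G : Regs KR),
    clearsCost G ks ≤ 2 * (ks.map fun k => (G k).length).sum + ks.length
  | [], _ => by simp [clearsCost]
  | k :: ks, G => by
    have ih := clearsCost_le ks (update G k [])
    have hle : (ks.map fun j => (update G k [] j).length).sum ≤ (ks.map fun j => (G j).length).sum := by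
      apply List.sum_le_sum
      intro j _
      by_cases hj : j = k
      · subst hj; simp
      · rw [update_of_ne hj]
    simp only [clearsCost, List.map_cons, List.sum_cons, List.length_cons]
    omega

/-! ### The tests stage -/

/-- The eight comparison tests on the products. [folklore] -/
def T8 : List (KR × KR × Bool) :=
  [(.mnp, .pa, true), (.mnp, .pb, false), (.mxp, .pc, true), (.mxp, .pd, false),
    (.pa, .cut, true), (.cut, .pa, true), (.pd, .hib, true), (.hib, .pd, true)]

/-- `T8` avoids `ok`. [folklore] -/
theorem okFree_T8 : OkFree T8 := by
  intro x hx
  simp only [T8, List.mem_cons, List.not_mem_nil, or_false] at hx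
  rcases hx with rfl | rfl | rfl | rfl | rfl | rfl | rfl | rfl <;> exact ⟨by decide, by decide⟩

/-- **The tests stage**: the eight comparisons, then `t := lo + 1` and `hi ≤ t`. [folklore] -/
def tests : Com CR := leTests T8 ;; addConst .lo [true] .t ;; leTest .t .hi true

/-- The outcome of the tests stage. [folklore] -/
def testsVal (G : Regs KR) : Bool :=
  allVal G T8 && decide (bitsToNat (G .hi) ≤ bitsToNat (G .lo) + 1)

/-- **Simulation of the tests stage.** [folklore] -/
theorem runs_tests (zv : List Bool) (M : Regs MOwn) (G : Regs KR) (o : Bool) (hok : G .ok = flag o)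
    (ht : G .t = []) :
    Runs tests (st (AReg.file [] [] zv [] [] [] [] []) M G)
      (st (AReg.file [] [] zv [] [] [] [] []) M
        (update (update G .t (addRes (G .lo) [true])) .ok (flag (o && testsVal G))))
      (testsCost G T8 + 59 * (G KR.lo).length + 28 * (G KR.hi).length + 136) := by
  have h1 := runs_leTests zv M T8 okFree_T8 G o hok
  set G₁ := update G .ok (flag (o && allVal G T8)) with hG₁
  have h2 := runs_addConst .lo [true] .t zv M G₁ (by simp [G₁, ht])
  have e1 : G₁ .lo = G .lo := by simp [G₁]
  rw [e1] at h2
  set G₂ := update G₁ .t (addRes (G .lo) [true]) with hG₂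
  have h3 := runs_leTest .t .hi true (o && allVal G T8) zv M G₂ (by simp [G₂, G₁])
  have e2 : G₂ .t = addRes (G .lo) [true] := by simp [G₂]
  have e3 : G₂ .hi = G .hi := by simp [G₂, G₁]
  have hv : leVal G₂ .t .hi true = decide (bitsToNat (G .hi) ≤ bitsToNat (G .lo) + 1) := by
    simp [leVal, e2, e3, bitsToNat_addRes]
  rw [hv, e2, e3] at h3
  have hl := length_addRes_le (G .lo) [true]
  refine (h1.seq (h2.seq h3)).of_eq ?_ ?_
  · simp only [G₂, G₁, testsVal, Bool.and_assoc]
    rw [update_comm (by decide : (KR.ok : KR) ≠ KR.t), update_idem]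
  · simp only [List.length_singleton] at hl ⊢
    omega

/-! ### The whole check -/

/-- The temporaries of the check. [folklore] -/
def temps : List KR := [.t, .pa, .pb, .pc, .pd, .mnp, .mxp]

/-- The temporaries are clean. [folklore] -/
def Clean (G : Regs KR) : Prop := ∀ k ∈ temps, G k = []

/-- The main body, run only when the budget test passed: products, tests, clears. [folklore] -/
def main (wP : List Bool) : Com CR := prods wP ;; tests ;; clears temps

/-- The total length of the inputs of the check. [folklore] -/
def fsum (G : Regs KR) (wP : List Bool) : ℕ :=
  (G .lo).length + (G .hi).length + (G .mn).length + (G .mx).length + (G .cut).length +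
    (G .hib).length + (G .c1).length + (G .bmax).length + (G .beta).length + wP.length

/-- `afterProds` only touches temporaries. [folklore] -/
theorem afterProds_of_not_mem (G : Regs KR) (wP : List Bool) {k : KR} (hk : k ∉ temps) :
    afterProds G wP k = G k := by
  simp only [temps, List.mem_cons, List.not_mem_nil, or_false, not_or] at hk
  obtain ⟨-, h1, h2, h3, h4, h5, h6⟩ := hk
  simp [afterProds, update_of_ne, h1, h2, h3, h4, h5, h6]

/-- `afterProds` commutes with writing `ok`. [folklore] -/
theorem afterProds_update_ok (G : Regs KR) (wP v : List Bool) :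
    afterProds (update G .ok v) wP = update (afterProds G wP) .ok v := by
  funext k
  by_cases hk : k = .ok
  · subst hk
    rw [update_self, afterProds_of_not_mem _ _ (by decide), update_self]
  · rw [update_of_ne hk]
    simp [afterProds, PA, PB, PC, PD, update_apply, hk]

/-- `testsVal` ignores `ok`. [folklore] -/
theorem testsVal_update_ok (G : Regs KR) (v : List Bool) :
    testsVal (update G .ok v) = testsVal G := by
  unfold testsVal
  rw [allVal_update_ok G v T8 okFree_T8]
  simp

/-- A value bound is a size bound. [folklore] -/
theorem size_le_length_of_le {v w : List Bool} (h : bitsToNat v ≤ bitsToNat w) :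
    (bitsToNat v).size ≤ w.length :=
  Nat.size_le.2 (lt_of_le_of_lt h (bitsToNat_lt w))

/-- **Simulation of the main body.** [folklore] -/
theorem runs_main (wP zv : List Bool) (G : Regs KR) (o : Bool) (hok : G .ok = flag o)
    (hcl : Clean G) (hlo : (bitsToNat (G .lo)).size ≤ (G .bmax).length)
    (hhi : (bitsToNat (G .hi)).size ≤ (G .bmax).length) :
    Runs (main wP) (st (AReg.file [] [] zv [] [] [] [] []) (MOwn.file [] [] [] []) G)
      (st (AReg.file [] [] zv [] [] [] [] []) (MOwn.file [] [] [] [])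
        (update G .ok (flag (o && testsVal (afterProds G wP)))))
      (1200 * (fsum G wP + 1) + 100 * ((G KR.bmax).length + (G KR.beta).length + 1) ^ 2) := by
  have ht0 : G .t = [] := hcl .t (by simp [temps])
  have hpa : G .pa = [] := hcl .pa (by simp [temps])
  have hpb : G .pb = [] := hcl .pb (by simp [temps])
  have hpc : G .pc = [] := hcl .pc (by simp [temps])
  have hpd : G .pd = [] := hcl .pd (by simp [temps])
  have hmnp : G .mnp = [] := hcl .mnp (by simp [temps])
  have hmxp : G .mxp = [] := hcl .mxp (by simp [temps])
  have h1 := runs_prods wP zv G hpa hpb hpc hpd hmxp hmnp hlo hhi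
  set G₂ := afterProds G wP with hG₂
  have hok₂ : G₂ .ok = flag o := by rw [hG₂, afterProds_of_not_mem _ _ (by decide)]; exact hok
  have ht₂ : G₂ .t = [] := by simp [G₂, afterProds, ht0]
  have h2 := runs_tests zv (MOwn.file [] [] [] []) G₂ o hok₂ ht₂
  set G₃ := update (update G₂ .t (addRes (G₂ .lo) [true])) .ok (flag (o && testsVal G₂)) with hG₃
  have h3 := runs_clears (AReg.file [] [] zv [] [] [] [] []) (MOwn.file [] [] [] []) temps G₃
  -- the final bank
  have hfin : cleared G₃ temps = update G .ok (flag (o && testsVal G₂)) := by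
    funext k
    by_cases hk : k ∈ temps
    · rw [cleared_of_mem _ _ _ hk]
      have hko : k ≠ .ok := by rintro rfl; simp [temps] at hk
      rw [update_of_ne hko, hcl k hk]
    · rw [cleared_of_not_mem _ _ _ hk]
      by_cases hko : k = .ok
      · subst hko; simp [G₃]
      · have hkt : k ≠ .t := by rintro rfl; simp [temps] at hk
        rw [hG₃, update_of_ne hko, update_of_ne hkt, update_of_ne hko, hG₂,
          afterProds_of_not_mem _ _ hk]
  -- register values after the products
  have e_lo : G₂ .lo = G .lo := afterProds_of_not_mem _ _ (by decide)
  have e_hi : G₂ .hi = G .hi := afterProds_of_not_mem _ _ (by decide)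
  have e_cut : G₂ .cut = G .cut := afterProds_of_not_mem _ _ (by decide)
  have e_hib : G₂ .hib = G .hib := afterProds_of_not_mem _ _ (by decide)
  have e_pa : G₂ .pa = PA G := by simp [G₂, afterProds]
  have e_pb : G₂ .pb = PB G := by simp [G₂, afterProds]
  have e_pc : G₂ .pc = PC G := by simp [G₂, afterProds]
  have e_pd : G₂ .pd = PD G := by simp [G₂, afterProds]
  have e_mnp : G₂ .mnp = tsub (G .mn) (G .c1) := by simp [G₂, afterProds]
  have e_mxp : G₂ .mxp = addRes (G .mx) wP := by simp [G₂, afterProds]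
  have lpa := length_PA_le G hlo
  have lpb := length_PB_le G hlo
  have lpc := length_PC_le G hhi
  have lpd := length_PD_le G hhi
  have lmnp := length_tsub_le (G .mn) (G .c1)
  have lmxp := length_addRes_le (G .mx) wP
  have lT := length_addRes_le (G .lo) [true]
  -- the cost of the tests
  have hT : testsCost G₂ T8 ≤ 56 * ((G .mn).length + (G .mx).length + wP.length +
      (G .cut).length + (G .hib).length) +
      336 * ((G .bmax).length + (G .beta).length + 1) + 256 := by
    simp only [testsCost, T8, e_mnp, e_pa, e_pb, e_mxp, e_pc, e_pd, e_cut, e_hib]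
    omega
  -- the cost of the clears
  have hC : clearsCost G₃ temps ≤ 2 * ((G .lo).length + (G .mn).length + (G .mx).length +
      wP.length) + 12 * ((G .bmax).length + (G .beta).length + 1) + 13 := by
    have h0 := clearsCost_le temps G₃
    have l1 : (G₃ .t).length ≤ (G .lo).length + 2 := by
      simp only [G₃, ne_eq, reduceCtorEq, not_false_eq_true, update_of_ne, update_self, e_lo]
      simpa using lT
    have l2 : (G₃ .pa).length ≤ (G .bmax).length + (G .beta).length + 1 := by
      simpa [G₃, e_pa] using lpa
    have l3 : (G₃ .pb).length ≤ (G .bmax).length + 2 * (G .beta).length + 2 := by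
      simpa [G₃, e_pb] using lpb
    have l4 : (G₃ .pc).length ≤ (G .bmax).length + (G .beta).length + 1 := by
      simpa [G₃, e_pc] using lpc
    have l5 : (G₃ .pd).length ≤ (G .bmax).length + 2 * (G .beta).length + 2 := by
      simpa [G₃, e_pd] using lpd
    have l6 : (G₃ .mnp).length ≤ (G .mn).length := by simpa [G₃, e_mnp] using lmnp
    have l7 : (G₃ .mxp).length ≤ (G .mx).length + wP.length + 1 := by simpa [G₃, e_mxp] using lmxp
    simp only [temps, List.map_cons, List.map_nil, List.sum_cons, List.sum_nil, List.length_cons,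
      List.length_nil] at h0 ⊢
    omega
  refine ((h1.seq (h2.seq h3)).of_eq (by rw [hfin]) ?_)
  rw [e_lo, e_hi] 
  unfold fsum
  omega

/-- **The outcome of the check** on the values of the registers. [folklore] -/
def chkVal (G : Regs KR) (wP : List Bool) : Bool :=
  (leVal G .bmax .lo true && leVal G .bmax .hi true) && testsVal (afterProds G wP)

/-- **The one-stack arithmetic check**: the budget test, then — only if it passed — the main
body. [cite: PaulEtAl1983, §3] -/
def chk1 (wP : List Bool) : Com CR :=
  leTest .bmax .lo true ;; leTest .bmax .hi true ;; copy (kr .ok) (kr .t) (ar .s) (ar .t) ;;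
    pop (kr .t) (main wP) skip skip

/-- **Simulation of the one-stack arithmetic check.** [cite: PaulEtAl1983, §3] -/
theorem runs_chk1 (wP zv : List Bool) (G : Regs KR) (o : Bool) (hok : G .ok = flag o)
    (hcl : Clean G) :
    Runs (chk1 wP) (st (AReg.file [] [] zv [] [] [] [] []) (MOwn.file [] [] [] []) G)
      (st (AReg.file [] [] zv [] [] [] [] []) (MOwn.file [] [] [] [])
        (update G .ok (flag (o && chkVal G wP))))
      (1400 * (fsum G wP + 1) + 100 * ((G KR.bmax).length + (G KR.beta).length + 1) ^ 2) := by
  have ht0 : G .t = [] := hcl .t (by simp [temps])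
  have h1 := runs_leTest .bmax .lo true o zv (MOwn.file [] [] [] []) G hok
  set s1 := leVal G .bmax .lo true with hs1
  set G₁ := update G .ok (flag (o && s1)) with hG₁
  have h2 := runs_leTest .bmax .hi true (o && s1) zv (MOwn.file [] [] [] []) G₁ (by simp [G₁])
  have ev2 : leVal G₁ .bmax .hi true = leVal G .bmax .hi true := leVal_update_of_ne G _ (by decide)
    (by decide) _
  rw [ev2] at h2
  set s2 := leVal G .bmax .hi true with hs2
  have eG : update G₁ .ok (flag (o && s1 && s2)) = update G .ok (flag (o && s1 && s2)) := by
    simp [G₁]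
  rw [eG] at h2
  set o₁ := o && s1 && s2 with ho₁
  set G₂ := update G .ok (flag o₁) with hG₂
  have hlen1 : (G₁ .bmax).length = (G .bmax).length := by simp [G₁]
  have hlen2 : (G₁ .hi).length = (G .hi).length := by simp [G₁]
  rw [hlen1, hlen2] at h2
  have h3 := runs_copy (a := kr .ok) (b := kr .t) (t := ar .s) (u := ar .t) (by simp) (by simp)
    (by simp) (by simp) (by simp) (by simp)
    (st (AReg.file [] [] zv [] [] [] [] []) (MOwn.file [] [] [] []) G₂) rfl rfl
  have et : G₂ .t = [] := by simp [G₂, ht0]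
  simp only [st_kr, et, List.append_nil, update_st_kr] at h3
  have eok : G₂ .ok = flag o₁ := by simp [G₂]
  rw [eok] at h3
  -- the branch
  have h4 : Runs (pop (kr .t) (main wP) skip skip)
      (st (AReg.file [] [] zv [] [] [] [] []) (MOwn.file [] [] [] []) (update G₂ .t (flag o₁)))
      (st (AReg.file [] [] zv [] [] [] [] []) (MOwn.file [] [] [] [])
        (update G .ok (flag (o && chkVal G wP))))
      (1200 * (fsum G wP + 1) + 100 * ((G KR.bmax).length + (G KR.beta).length + 1) ^ 2 + 2) := by
    cases ho : o₁
    · -- budget test failed (or `ok` was already clear): skip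
      refine (Runs.pop_nil (main wP) skip (by simp) (Runs.skip _)).of_eq ?_ (by omega)
      simp only [flag_false]
      rw [← et, update_eq_self, hG₂, ho]
      congr 2
      unfold chkVal
      rw [← hs1, ← hs2]
      have : (o && s1 && s2) = false := ho
      revert this; cases o <;> cases s1 <;> cases s2 <;> simp
    · -- passed: run the main body
      have hs : s1 = true ∧ s2 = true ∧ o = true := by
        have : (o && s1 && s2) = true := ho
        revert this; cases o <;> cases s1 <;> cases s2 <;> simp
      have hlo : (bitsToNat (G .lo)).size ≤ (G .bmax).length := by
        have := hs.1; rw [hs1] at this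
        exact size_le_length_of_le (by simpa [leVal] using this)
      have hhi : (bitsToNat (G .hi)).size ≤ (G .bmax).length := by
        have := hs.2.1; rw [hs2] at this
        exact size_le_length_of_le (by simpa [leVal] using this)
      have hcl₂ : Clean G₂ := by
        intro k hk
        have hko : k ≠ .ok := by rintro rfl; simp [temps] at hk
        simp only [G₂, update_of_ne hko]
        exact hcl k hk
      have hm := runs_main wP zv G₂ true (by simp [G₂, ho]) hcl₂ (by simpa [G₂] using hlo)
        (by simpa [G₂] using hhi)
      have efs : fsum G₂ wP = fsum G wP := by simp [fsum, G₂]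
      have eb1 : (G₂ .bmax).length = (G .bmax).length := by simp [G₂]
      have eb2 : (G₂ .beta).length = (G .beta).length := by simp [G₂]
      rw [efs, eb1, eb2] at hm
      refine (Runs.pop_true' skip skip (w := []) (by simp) ?_ hm).of_eq ?_ (by omega)
      · simp only [update_st_kr, update_idem]
        rw [← et, update_eq_self]
      · rw [hG₂, afterProds_update_ok, testsVal_update_ok, update_idem, Bool.true_and]
        congr 2
        unfold chkVal
        rw [← hs1, ← hs2, hs.1, hs.2.1, hs.2.2]
        simp
  refine (h1.seq (h2.seq (h3.seq h4))).of_eq rfl ?_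
  have : (flag o₁).length ≤ 1 := by cases o₁ <;> simp
  unfold fsum
  omega

/-! ### The meaning of the outcome -/

/-- **The conditions checked**, on natural numbers: the budget, the two divisions with remainder,
the two products, and "at most two height blocks". [folklore] -/
def ChkProp (lo hi mn mx cut hib β c1 bmax P : ℕ) : Prop :=
  lo ≤ bmax ∧ hi ≤ bmax ∧ lo * β ≤ mn - c1 ∧ mn - c1 < lo * β + β ∧ hi * β ≤ mx + P ∧
    mx + P < hi * β + β ∧ cut = lo * β ∧ hib = hi * β + β ∧ hi ≤ lo + 1

/-- **`chkVal` decides `ChkProp`** on the values of the registers. [folklore] -/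
theorem chkVal_iff (G : Regs KR) (wP : List Bool) :
    chkVal G wP = true ↔
      ChkProp (bitsToNat (G .lo)) (bitsToNat (G .hi)) (bitsToNat (G .mn)) (bitsToNat (G .mx))
        (bitsToNat (G .cut)) (bitsToNat (G .hib)) (bitsToNat (G .beta)) (bitsToNat (G .c1))
        (bitsToNat (G .bmax)) (bitsToNat wP) := by
  have e_pa : afterProds G wP .pa = PA G := by simp [afterProds]
  have e_pb : afterProds G wP .pb = PB G := by simp [afterProds]
  have e_pc : afterProds G wP .pc = PC G := by simp [afterProds]
  have e_pd : afterProds G wP .pd = PD G := by simp [afterProds]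
  have e_mnp : afterProds G wP .mnp = tsub (G .mn) (G .c1) := by simp [afterProds]
  have e_mxp : afterProds G wP .mxp = addRes (G .mx) wP := by simp [afterProds]
  have e_cut : afterProds G wP .cut = G .cut := afterProds_of_not_mem _ _ (by decide)
  have e_hib : afterProds G wP .hib = G .hib := afterProds_of_not_mem _ _ (by decide)
  have e_lo : afterProds G wP .lo = G .lo := afterProds_of_not_mem _ _ (by decide)
  have e_hi : afterProds G wP .hi = G .hi := afterProds_of_not_mem _ _ (by decide)
  simp only [chkVal, testsVal, allVal, T8, leVal, cond_true, cond_false, e_pa, e_pb, e_pc, e_pd,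
    e_mnp, e_mxp, e_cut, e_hib, e_lo, e_hi, bitsToNat_PA, bitsToNat_PB, bitsToNat_PC, bitsToNat_PD,
    bitsToNat_tsub, bitsToNat_addRes, Bool.and_eq_true, decide_eq_true_eq, Bool.and_true, ChkProp]
  constructor
  · rintro ⟨⟨h1, h2⟩, ⟨h3, h4, h5, h6, h7, h8, h9, h10⟩, h11⟩
    exact ⟨h1, h2, h3, h4, h5, h6, le_antisymm h7 h8, le_antisymm h9 h10, h11⟩
  · rintro ⟨h1, h2, h3, h4, h5, h6, h7, h8, h9⟩
    exact ⟨⟨h1, h2⟩, ⟨h3, h4, h5, h6, h7.le, h7.ge, h8.le, h8.ge⟩, h9⟩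

/-- **`ChkProp` is the pair of divisions** defining `lo` and `hi` (for `β > 0`), the two
products, the budget and "at most two blocks". [folklore] -/
theorem chkProp_iff {lo hi mn mx cut hib β c1 bmax P : ℕ} (hβ : 0 < β) :
    ChkProp lo hi mn mx cut hib β c1 bmax P ↔
      lo ≤ bmax ∧ hi ≤ bmax ∧ lo = (mn - c1) / β ∧ hi = (mx + P) / β ∧ cut = lo * β ∧
        hib = (hi + 1) * β ∧ hi ≤ lo + 1 := by
  have hdiv : ∀ q x : ℕ, q = x / β ↔ q * β ≤ x ∧ x < q * β + β := by
    intro q x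
    constructor
    · rintro rfl
      refine ⟨Nat.div_mul_le_self x β, ?_⟩
      have h2 := (Nat.div_lt_iff_lt_mul hβ).1 (Nat.lt_succ_self (x / β))
      rw [Nat.succ_mul] at h2
      exact h2
    · rintro ⟨h1, h2⟩
      apply le_antisymm
      · exact (Nat.le_div_iff_mul_le hβ).2 h1
      · have : x / β < q + 1 := (Nat.div_lt_iff_lt_mul hβ).2 (by rw [Nat.succ_mul]; exact h2)
        omega
  unfold ChkProp
  rw [hdiv lo (mn - c1), hdiv hi (mx + P), Nat.succ_mul]
  tauto

end PPSTChk

end Literature.Computability.Complexity
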